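import Literature.MathematicalPhysics.AQFT.OSAxiomsSchwinger
import Literature.MathematicalPhysics.QuantumLattice.EuclideanAction
import Literature.MathematicalPhysics.QuantumLattice.SchwartzTensor
import HarnessLib

/-!
# Stub `stub_timeSeparatedOfSeparated` (N3b) of line `Sketch`, crux `WeakCouplingHypercubicLimit` (reshape r15)

Crux `stmt-QuantumFields-16120` (`Summit.QuantumFields.YangMills.Theses.PencilRigidity.WeakCouplingHypercubicLimit`),
line `Sketch`, registered stub `stub_timeSeparatedOfSeparated` (N3b; r15b form with the three `Disjoint` hypotheses —
without them the statement fails for `S₁ 3 = δ_{(a,b,b)}`, `S₁ n = 0` otherwise, and `g = h`).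

**Euclidean symmetry puts a coordinate-separated triple into time-separated position.**  For a one-field continuum
Schwinger family `S₁` on `ℝ⁴` which, on `⁰𝒮`, is symmetric (E3), translation invariant and invariant under the signed
permutations of the axes (`W(B₄)`), and a pairwise-disjoint triple `f, g, h` in `ρ`-balls split by a hyperplane
`{y_m = c}`, the value `κ₃(f, g, h) ≠ 0` is that of a TIME-separated triple (first function in `{y⁰ < 0}`, the others
in `{0 < y⁰}`).  Proof: relabel by E3 so that the isolated function comes first (`S₁ n (⊗ (v ∘ σ)) = S₁ n (⊗ v)` for
pairwise disjoint factors); translate by `c e_m`, swap the axes `0 ↔ m` (`LinearIsometryEquiv.piLpCongrLeft`) and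
time-reflect if the isolated ball lies above; the transported functions `u ∘ (y ↦ R⁻¹ y − a)` live in the preimages of
the balls, their tensors stay off-diagonal, and every `S₁`-term of `κ₃` is unchanged (Osterwalder–Schrader 1973, §2–3:
(E1), (E3) on `⁰𝒮`; Glimm–Jaffe 1987, §6.1).
-/

noncomputable section

open scoped SchwartzMap
open MeasureTheory Filter Topology
open Literature.MathematicalPhysics.AQFT Literature.MathematicalPhysics.QuantumLattice

namespace Summit.QuantumFields.YangMills.Theorems.WeakCouplingHypercubicLimit.TraceNormColdPressure

local notation "E4" => EuclideanSpace ℝ (Fin 4)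

namespace TimeSeparatedOfSeparated

/-- `(g, f, h)` is `(f, g, h)` relabelled by the transposition `(0 1)`. [folklore] -/
theorem vec3_swap01 {α : Type*} (f g h : α) : ![g, f, h] = ![f, g, h] ∘ (Equiv.swap (0 : Fin 3) 1) := by
  funext i; fin_cases i <;> rfl

/-- `(h, f, g)` is `(f, g, h)` relabelled by the `3`-cycle `(1 2)(0 1)`. [folklore] -/
theorem vec3_cycle {α : Type*} (f g h : α) :
    ![h, f, g] = ![f, g, h] ∘ (Equiv.swap (1 : Fin 3) 2 * Equiv.swap (0 : Fin 3) 1) := by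
  funext i; fin_cases i <;> rfl

/-- `(g, f)` is `(f, g)` relabelled by the transposition `(0 1)`. [folklore] -/
theorem vec2_swap {α : Type*} (f g : α) : ![g, f] = ![f, g] ∘ (Equiv.swap (0 : Fin 2) 1) := by
  funext i; fin_cases i <;> rfl

/-- Mapping a triple. [folklore] -/
theorem map_vec3 {α β : Type*} (T : α → β) (u v w : α) : ![T u, T v, T w] = fun j => T (![u, v, w] j) := by
  funext j; fin_cases j <;> rfl

/-- Mapping a pair. [folklore] -/
theorem map_vec2 {α β : Type*} (T : α → β) (u v : α) : ![T u, T v] = fun j => T (![u, v] j) := by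
  funext j; fin_cases j <;> rfl

/-- Mapping a singleton. [folklore] -/
theorem map_vec1 {α β : Type*} (T : α → β) (u : α) : ![T u] = fun j => T (![u] j) := by
  funext j; fin_cases j; rfl

/-- Pairwise disjointness of the supports of a triple from the three pairs. [folklore] -/
theorem pairwise_disjoint_three {u v w : 𝓢(E4, ℂ)}
    (huv : Disjoint (tsupport (u : E4 → ℂ)) (tsupport (v : E4 → ℂ)))
    (huw : Disjoint (tsupport (u : E4 → ℂ)) (tsupport (w : E4 → ℂ)))
    (hvw : Disjoint (tsupport (v : E4 → ℂ)) (tsupport (w : E4 → ℂ))) :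
    ∀ i j : Fin 3, i ≠ j →
      Disjoint (tsupport ((![u, v, w] i : 𝓢(E4, ℂ)) : E4 → ℂ)) (tsupport ((![u, v, w] j : 𝓢(E4, ℂ)) : E4 → ℂ)) := by
  intro i j hij
  fin_cases i <;> fin_cases j
  all_goals first | exact absurd rfl hij | simpa using huv | simpa using huv.symm | simpa using huw | simpa using huw.symm | simpa using hvw | simpa using hvw.symm

/-- Pairwise disjointness of the supports of a pair. [folklore] -/
theorem pairwise_disjoint_two {u v : 𝓢(E4, ℂ)} (huv : Disjoint (tsupport (u : E4 → ℂ)) (tsupport (v : E4 → ℂ))) :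
    ∀ i j : Fin 2, i ≠ j →
      Disjoint (tsupport ((![u, v] i : 𝓢(E4, ℂ)) : E4 → ℂ)) (tsupport ((![u, v] j : 𝓢(E4, ℂ)) : E4 → ℂ)) := by
  intro i j hij
  fin_cases i <;> fin_cases j
  all_goals first | exact absurd rfl hij | simpa using huv | simpa using huv.symm

/-- Pairwise disjointness is vacuous for a singleton. [folklore] -/
theorem pairwise_disjoint_one (u : 𝓢(E4, ℂ)) :
    ∀ i j : Fin 1, i ≠ j →
      Disjoint (tsupport ((![u] i : 𝓢(E4, ℂ)) : E4 → ℂ)) (tsupport ((![u] j : 𝓢(E4, ℂ)) : E4 → ℂ)) :=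
  fun i j hij => absurd (Subsingleton.elim i j) hij

/-- The support of a tensor product lies over the supports of its factors. [folklore] -/
theorem mem_tsupport_of_tensorFin {n : ℕ} (v : Fin n → 𝓢(E4, ℂ)) {z : Fin n → E4}
    (hz : z ∈ tsupport (SchwartzMap.tensorFin n v : (Fin n → E4) → ℂ)) (j : Fin n) :
    z j ∈ tsupport (v j : E4 → ℂ) := by
  by_contra hj
  refine (notMem_tsupport_iff_eventuallyEq.2 ?_) hz
  filter_upwards [((continuous_apply j).tendsto z).eventually (notMem_tsupport_iff_eventuallyEq.1 hj)]
    with y hy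
  rw [SchwartzMap.tensorFin_apply]
  exact Finset.prod_eq_zero (Finset.mem_univ j) hy

/-- A tensor product of test functions with pairwise disjoint supports is off-diagonal (`∈ ⁰𝒮`). [folklore] -/
theorem isOffDiagonal_tensorFin_of_disjoint {n : ℕ} (v : Fin n → 𝓢(E4, ℂ))
    (hv : ∀ i j, i ≠ j → Disjoint (tsupport (v i : E4 → ℂ)) (tsupport (v j : E4 → ℂ))) :
    IsOffDiagonal (SchwartzMap.tensorFin n v) :=
  IsOffDiagonal.of_tsupport_subset fun z hz hzc => by
    obtain ⟨i, j, hij, hzij⟩ := hzc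
    exact Set.disjoint_left.1 (hv i j hij) (hzij ▸ mem_tsupport_of_tensorFin v hz i) (mem_tsupport_of_tensorFin v hz j)

/-- Support of a translated test function `u (· − a) = u ∘ (· − a)`. [folklore] -/
theorem tsupport_translateTest_subset (a : E4) (u : 𝓢(E4, ℂ)) :
    tsupport ((translateTest a u : 𝓢(E4, ℂ)) : E4 → ℂ) ⊆ (fun y => y - a) ⁻¹' tsupport (u : E4 → ℂ) :=
  tsupport_comp_subset_preimage (u : E4 → ℂ) (f := fun y => y - a) (continuous_id.sub continuous_const)

/-- Support of a rotated test function `u ∘ R⁻¹`. [folklore] -/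
theorem tsupport_linActTest_subset (R : E4 ≃ₗᵢ[ℝ] E4) (u : 𝓢(E4, ℂ)) :
    tsupport ((linActTest R u : 𝓢(E4, ℂ)) : E4 → ℂ) ⊆ R.symm ⁻¹' tsupport (u : E4 → ℂ) :=
  tsupport_comp_subset_preimage (u : E4 → ℂ) (f := R.symm) R.symm.continuous

/-- Support of the transported test function `u ∘ (y ↦ R⁻¹ y − a)`. [folklore] -/
theorem mem_tsupport_of_transport (R : E4 ≃ₗᵢ[ℝ] E4) (a : E4) (u : 𝓢(E4, ℂ)) {y : E4}
    (hy : y ∈ tsupport ((linActTest R (translateTest a u) : 𝓢(E4, ℂ)) : E4 → ℂ)) :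
    R.symm y - a ∈ tsupport (u : E4 → ℂ) :=
  tsupport_translateTest_subset a u (tsupport_linActTest_subset R _ hy)

/-- A map of test functions pulling supports back along a point map preserves pairwise disjointness of supports.
[folklore] -/
theorem pairwise_disjoint_map {T : 𝓢(E4, ℂ) → 𝓢(E4, ℂ)} {φ : E4 → E4}
    (hT : ∀ (u : 𝓢(E4, ℂ)) (y : E4), y ∈ tsupport ((T u : 𝓢(E4, ℂ)) : E4 → ℂ) → φ y ∈ tsupport (u : E4 → ℂ))
    {n : ℕ} (v : Fin n → 𝓢(E4, ℂ))
    (hv : ∀ i j, i ≠ j → Disjoint (tsupport (v i : E4 → ℂ)) (tsupport (v j : E4 → ℂ))) :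
    ∀ i j, i ≠ j →
      Disjoint (tsupport ((T (v i) : 𝓢(E4, ℂ)) : E4 → ℂ)) (tsupport ((T (v j) : 𝓢(E4, ℂ)) : E4 → ℂ)) :=
  fun i j hij => Set.disjoint_left.2 fun y hyi hyj =>
    Set.disjoint_left.1 (hv i j hij) (hT _ y hyi) (hT _ y hyj)

/-- Translating a tensor product translates each factor. [folklore] -/
theorem translateMulti_tensorFin (a : E4) {n : ℕ} (v : Fin n → 𝓢(E4, ℂ)) :
    translateMulti a (SchwartzMap.tensorFin n v) = SchwartzMap.tensorFin n fun j => translateTest a (v j) := by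
  ext x
  simp [SchwartzMap.tensorFin_apply]

/-- Rotating a tensor product rotates each factor. [folklore] -/
theorem linActMulti_tensorFin (R : E4 ≃ₗᵢ[ℝ] E4) {n : ℕ} (v : Fin n → 𝓢(E4, ℂ)) :
    linActMulti R (SchwartzMap.tensorFin n v) = SchwartzMap.tensorFin n fun j => linActTest R (v j) := by
  ext x
  simp [SchwartzMap.tensorFin_apply]

variable (S₁ : SchwingerFamily E4)
variable (hE3 : ∀ (n : ℕ) (π : Equiv.Perm (Fin n)) (F : 𝓢((Fin n → E4), ℂ)), IsOffDiagonal F →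
  S₁ n (permTest π F) = S₁ n F)
variable (htr : ∀ (n : ℕ) (a : E4) (F : 𝓢((Fin n → E4), ℂ)), IsOffDiagonal F →
  S₁ n (translateMulti a F) = S₁ n F)
variable (hSP : ∀ (n : ℕ) (R : E4 ≃ₗᵢ[ℝ] E4),
  (∀ i : Fin 4, ∃ j : Fin 4, R (EuclideanSpace.single i 1) = EuclideanSpace.single j 1 ∨
    R (EuclideanSpace.single i 1) = -EuclideanSpace.single j 1) →
  ∀ F : 𝓢((Fin n → E4), ℂ), IsOffDiagonal F → S₁ n (linActMulti R F) = S₁ n F)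

include hE3 in
/-- **E3 on tensors with pairwise disjoint factors**: permuting the factors does not change `S₁ n`
(OS 1973, §3 (E3) on `⁰𝒮`). [folklore] -/
theorem apply_tensorFin_perm {n : ℕ} (σ : Equiv.Perm (Fin n)) (v : Fin n → 𝓢(E4, ℂ))
    (hv : ∀ i j, i ≠ j → Disjoint (tsupport (v i : E4 → ℂ)) (tsupport (v j : E4 → ℂ))) :
    S₁ n (SchwartzMap.tensorFin n (v ∘ σ)) = S₁ n (SchwartzMap.tensorFin n v) := by
  have h : IsTensorOf (permTest σ.symm (SchwartzMap.tensorFin n v)) (v ∘ σ) := by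
    simpa only [Equiv.symm_symm] using (isTensorOf_tensorFin v).permTest σ.symm
  rw [(isTensorOf_tensorFin (v ∘ σ)).unique h]
  exact hE3 n σ.symm _ (isOffDiagonal_tensorFin_of_disjoint v hv)

include htr hSP in
/-- **Transport invariance** of `S₁ n` on tensors with pairwise disjoint factors: for a signed permutation `R`
and a translation `a`, `S₁ n (⊗ⱼ vⱼ ∘ (R⁻¹ · − a)) = S₁ n (⊗ⱼ vⱼ)` (E1-type invariance on `⁰𝒮`). [folklore] -/
theorem apply_tensorFin_transport {R : E4 ≃ₗᵢ[ℝ] E4}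
    (hR : ∀ i : Fin 4, ∃ j : Fin 4, R (EuclideanSpace.single i 1) = EuclideanSpace.single j 1 ∨
      R (EuclideanSpace.single i 1) = -EuclideanSpace.single j 1)
    (a : E4) {n : ℕ} (v : Fin n → 𝓢(E4, ℂ))
    (hv : ∀ i j, i ≠ j → Disjoint (tsupport (v i : E4 → ℂ)) (tsupport (v j : E4 → ℂ))) :
    S₁ n (SchwartzMap.tensorFin n fun j => linActTest R (translateTest a (v j))) =
      S₁ n (SchwartzMap.tensorFin n v) := by
  have hv' := pairwise_disjoint_map (T := fun u : 𝓢(E4, ℂ) => translateTest a u)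
    (fun u y hy => tsupport_translateTest_subset a u hy) v hv
  rw [← linActMulti_tensorFin R (fun j => translateTest a (v j)),
    hSP n R hR _ (isOffDiagonal_tensorFin_of_disjoint _ hv'), ← translateMulti_tensorFin,
    htr n a _ (isOffDiagonal_tensorFin_of_disjoint v hv)]

/-- Coordinates of points of a closed ball: `|x_m − p_m| ≤ ρ`. [folklore] -/
theorem coord_bounds_of_mem_closedBall {x p : E4} {ρ : ℝ} (h : x ∈ Metric.closedBall p ρ) (m : Fin 4) :
    p m - ρ ≤ x m ∧ x m ≤ p m + ρ := by
  have h1 : |x m - p m| ≤ ρ := by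
    rw [← Real.dist_eq]; exact (PiLp.dist_apply_le x p m).trans (Metric.mem_closedBall.1 h)
  rw [abs_sub_le_iff] at h1
  constructor <;> linarith [h1.1, h1.2]

/-- The axis swap `0 ↔ m` moves coordinate `m` to coordinate `0`. [folklore] -/
theorem swapAxes_apply_zero (m : Fin 4) (v : E4) :
    (LinearIsometryEquiv.piLpCongrLeft 2 ℝ ℝ (Equiv.swap (0 : Fin 4) m) v) 0 = v m := by
  simp [LinearIsometryEquiv.piLpCongrLeft_apply, Equiv.piCongrLeft'_apply, Equiv.swap_apply_left]

/-- The axis swap is a signed permutation of the axes. [folklore] -/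
theorem swapAxes_signedPerm (m : Fin 4) :
    ∀ i : Fin 4, ∃ j : Fin 4,
      (LinearIsometryEquiv.piLpCongrLeft 2 ℝ ℝ (Equiv.swap (0 : Fin 4) m)) (EuclideanSpace.single i 1) =
          EuclideanSpace.single j 1 ∨
        (LinearIsometryEquiv.piLpCongrLeft 2 ℝ ℝ (Equiv.swap (0 : Fin 4) m)) (EuclideanSpace.single i 1) =
          -EuclideanSpace.single j 1 :=
  fun i => ⟨Equiv.swap (0 : Fin 4) m i, Or.inl (EuclideanSpace.piLpCongrLeft_single _ _ _)⟩

/-- Time reflection of an axis vector: `θ e_0 = −e_0`, `θ e_i = e_i` (`i ≠ 0`). [folklore] -/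
theorem timeReflection_single (i : Fin 4) :
    timeReflection 4 (EuclideanSpace.single i (1 : ℝ)) =
      if i = 0 then -EuclideanSpace.single i (1 : ℝ) else EuclideanSpace.single i 1 := by
  ext j
  simp only [timeReflection_apply]
  split_ifs with h1 h2 <;> simp_all [PiLp.single_apply]

/-- The axis swap followed by the time reflection is a signed permutation of the axes. [folklore] -/
theorem swapAxes_theta_signedPerm (m : Fin 4) :
    ∀ i : Fin 4, ∃ j : Fin 4,
      ((LinearIsometryEquiv.piLpCongrLeft 2 ℝ ℝ (Equiv.swap (0 : Fin 4) m)).trans (timeReflection 4))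
            (EuclideanSpace.single i 1) = EuclideanSpace.single j 1 ∨
        ((LinearIsometryEquiv.piLpCongrLeft 2 ℝ ℝ (Equiv.swap (0 : Fin 4) m)).trans (timeReflection 4))
            (EuclideanSpace.single i 1) = -EuclideanSpace.single j 1 := by
  intro i
  refine ⟨Equiv.swap (0 : Fin 4) m i, ?_⟩
  rw [LinearIsometryEquiv.trans_apply, EuclideanSpace.piLpCongrLeft_single, timeReflection_single]
  split_ifs; exacts [Or.inr rfl, Or.inl rfl]

include htr hSP in
/-- **Core transport.**  A pairwise-disjoint triple `(X, Y, Z)` in `ρ`-balls with `X` isolated by the hyperplane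
`{y_m = c}` (below or above, margin `ρ`) and `κ₃(X, Y, Z) ≠ 0` is moved by a translation and a signed permutation to
a time-separated triple (`X'` in `{y⁰ < 0}`, `Y', Z'` in `{0 < y⁰}`) with off-diagonal tensors and the same `κ₃`.
[folklore] -/
theorem core {X Y Z : 𝓢(E4, ℂ)} {pX pY pZ : E4} {ρ : ℝ}
    (hXs : tsupport (X : E4 → ℂ) ⊆ Metric.closedBall pX ρ)
    (hYs : tsupport (Y : E4 → ℂ) ⊆ Metric.closedBall pY ρ)
    (hZs : tsupport (Z : E4 → ℂ) ⊆ Metric.closedBall pZ ρ)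
    (hXY : Disjoint (tsupport (X : E4 → ℂ)) (tsupport (Y : E4 → ℂ)))
    (hXZ : Disjoint (tsupport (X : E4 → ℂ)) (tsupport (Z : E4 → ℂ)))
    (hYZ : Disjoint (tsupport (Y : E4 → ℂ)) (tsupport (Z : E4 → ℂ)))
    {m : Fin 4} {c : ℝ}
    (hsep : (pX m + ρ < c ∧ c + ρ < pY m ∧ c + ρ < pZ m) ∨ (c + ρ < pX m ∧ pY m + ρ < c ∧ pZ m + ρ < c))
    (hκ : S₁ 3 (SchwartzMap.tensorFin 3 ![X, Y, Z]) -
            S₁ 1 (SchwartzMap.tensorFin 1 ![X]) * S₁ 2 (SchwartzMap.tensorFin 2 ![Y, Z]) -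
          S₁ 1 (SchwartzMap.tensorFin 1 ![Y]) * S₁ 2 (SchwartzMap.tensorFin 2 ![X, Z]) -
          S₁ 1 (SchwartzMap.tensorFin 1 ![Z]) * S₁ 2 (SchwartzMap.tensorFin 2 ![X, Y]) +
          2 * (S₁ 1 (SchwartzMap.tensorFin 1 ![X]) * S₁ 1 (SchwartzMap.tensorFin 1 ![Y]) *
            S₁ 1 (SchwartzMap.tensorFin 1 ![Z])) ≠ 0) :
    ∃ (f' g' h' : 𝓢(E4, ℂ)) (Ffgh : 𝓢((Fin 3 → E4), ℂ))
      (Fgh Ffh Ffg : 𝓢((Fin 2 → E4), ℂ)) (Ff Fg Fh : 𝓢((Fin 1 → E4), ℂ)),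
      tsupport (f' : E4 → ℂ) ⊆ {y : E4 | y 0 < 0} ∧
      tsupport (g' : E4 → ℂ) ⊆ {y : E4 | 0 < y 0} ∧
      tsupport (h' : E4 → ℂ) ⊆ {y : E4 | 0 < y 0} ∧
      IsOffDiagonal Fgh ∧ IsTensorOf Ffgh ![f', g', h'] ∧ IsOffDiagonal Ffgh ∧ IsTensorOf Fgh ![g', h'] ∧
      IsTensorOf Ffh ![f', h'] ∧ IsTensorOf Ffg ![f', g'] ∧ IsTensorOf Ff ![f'] ∧ IsTensorOf Fg ![g'] ∧
      IsTensorOf Fh ![h'] ∧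
      S₁.toLabelled 3 (fun _ => ()) Ffgh - S₁.toLabelled 1 (fun _ => ()) Ff * S₁.toLabelled 2 (fun _ => ()) Fgh -
        S₁.toLabelled 1 (fun _ => ()) Fg * S₁.toLabelled 2 (fun _ => ()) Ffh -
        S₁.toLabelled 1 (fun _ => ()) Fh * S₁.toLabelled 2 (fun _ => ()) Ffg +
        2 * (S₁.toLabelled 1 (fun _ => ()) Ff * S₁.toLabelled 1 (fun _ => ()) Fg *
          S₁.toLabelled 1 (fun _ => ()) Fh) ≠ 0 := by
  -- the translation `a = -c e_m`: `(x + a)_m = x_m - c`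
  obtain ⟨a, hadd⟩ : ∃ a : E4, ∀ x : E4, (x + a) m = x m - c :=
    ⟨EuclideanSpace.single m (-c), fun x => by simp [sub_eq_add_neg]⟩
  -- the signed permutation `R`: the axis swap `0 ↔ m`, composed with `θ` when `X` lies above the hyperplane
  obtain ⟨R, hR, hRX, hRY, hRZ⟩ : ∃ R : E4 ≃ₗᵢ[ℝ] E4,
      (∀ i : Fin 4, ∃ j : Fin 4, R (EuclideanSpace.single i 1) = EuclideanSpace.single j 1 ∨
        R (EuclideanSpace.single i 1) = -EuclideanSpace.single j 1) ∧
      (∀ x ∈ tsupport (X : E4 → ℂ), (R (x + a)) 0 < 0) ∧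
      (∀ x ∈ tsupport (Y : E4 → ℂ), 0 < (R (x + a)) 0) ∧
      (∀ x ∈ tsupport (Z : E4 → ℂ), 0 < (R (x + a)) 0) := by
    rcases hsep with ⟨hX, hY, hZ⟩ | ⟨hX, hY, hZ⟩
    · refine ⟨LinearIsometryEquiv.piLpCongrLeft 2 ℝ ℝ (Equiv.swap (0 : Fin 4) m), swapAxes_signedPerm m,
        fun x hx => ?_, fun x hx => ?_, fun x hx => ?_⟩ <;> rw [swapAxes_apply_zero, hadd]
      · linarith [(coord_bounds_of_mem_closedBall (hXs hx) m).2]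
      · linarith [(coord_bounds_of_mem_closedBall (hYs hx) m).1]
      · linarith [(coord_bounds_of_mem_closedBall (hZs hx) m).1]
    · refine ⟨(LinearIsometryEquiv.piLpCongrLeft 2 ℝ ℝ (Equiv.swap (0 : Fin 4) m)).trans (timeReflection 4),
        swapAxes_theta_signedPerm m, fun x hx => ?_, fun x hx => ?_, fun x hx => ?_⟩ <;>
        rw [LinearIsometryEquiv.trans_apply, timeReflection_apply, if_pos rfl, swapAxes_apply_zero, hadd]
      · linarith [(coord_bounds_of_mem_closedBall (hXs hx) m).1]
      · linarith [(coord_bounds_of_mem_closedBall (hYs hx) m).2]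
      · linarith [(coord_bounds_of_mem_closedBall (hZs hx) m).2]
  -- supports of the transported functions `u ∘ (y ↦ R⁻¹ y − a)`
  have key : ∀ (u : 𝓢(E4, ℂ)) {y : E4},
      y ∈ tsupport ((linActTest R (translateTest a u) : 𝓢(E4, ℂ)) : E4 → ℂ) →
      ∃ x ∈ tsupport (u : E4 → ℂ), R (x + a) = y := fun u y hy =>
    ⟨R.symm y - a, mem_tsupport_of_transport R a u hy, by
      rw [sub_add_cancel, LinearIsometryEquiv.apply_symm_apply]⟩
  have hdisj : ∀ {n : ℕ} (v : Fin n → 𝓢(E4, ℂ)),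
      (∀ i j, i ≠ j → Disjoint (tsupport (v i : E4 → ℂ)) (tsupport (v j : E4 → ℂ))) →
      IsOffDiagonal (SchwartzMap.tensorFin n fun j => linActTest R (translateTest a (v j))) := fun v hv =>
    isOffDiagonal_tensorFin_of_disjoint _ (pairwise_disjoint_map
      (T := fun u : 𝓢(E4, ℂ) => linActTest R (translateTest a u)) (fun u y hy => mem_tsupport_of_transport R a u hy)
      v hv)
  refine ⟨linActTest R (translateTest a X), linActTest R (translateTest a Y), linActTest R (translateTest a Z),
    _, _, _, _, _, _, _, ?_, ?_, ?_, ?_, isTensorOf_tensorFin _, ?_, isTensorOf_tensorFin _,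
    isTensorOf_tensorFin _, isTensorOf_tensorFin _, isTensorOf_tensorFin _, isTensorOf_tensorFin _,
    isTensorOf_tensorFin _, ?_⟩
  · intro y hy
    obtain ⟨x, hx, rfl⟩ := key X hy
    exact hRX x hx
  · intro y hy
    obtain ⟨x, hx, rfl⟩ := key Y hy
    exact hRY x hx
  · intro y hy
    obtain ⟨x, hx, rfl⟩ := key Z hy
    exact hRZ x hx
  · rw [map_vec2 (fun x : 𝓢(E4, ℂ) => linActTest R (translateTest a x))]
    exact hdisj _ (pairwise_disjoint_two hYZ)
  · rw [map_vec3 (fun x : 𝓢(E4, ℂ) => linActTest R (translateTest a x))]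
    exact hdisj _ (pairwise_disjoint_three hXY hXZ hYZ)
  · -- every `S₁`-term of `κ₃` is transport invariant (longest tensors first: `![u, v]` is a tail of `![x, u, v]`)
    simp only [SchwingerFamily.toLabelled_apply]
    rw [map_vec3 (fun x : 𝓢(E4, ℂ) => linActTest R (translateTest a x)) X Y Z,
      map_vec2 (fun x : 𝓢(E4, ℂ) => linActTest R (translateTest a x)) Y Z,
      map_vec2 (fun x : 𝓢(E4, ℂ) => linActTest R (translateTest a x)) X Z,
      map_vec2 (fun x : 𝓢(E4, ℂ) => linActTest R (translateTest a x)) X Y,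
      map_vec1 (fun x : 𝓢(E4, ℂ) => linActTest R (translateTest a x)) X,
      map_vec1 (fun x : 𝓢(E4, ℂ) => linActTest R (translateTest a x)) Y,
      map_vec1 (fun x : 𝓢(E4, ℂ) => linActTest R (translateTest a x)) Z,
      apply_tensorFin_transport S₁ htr hSP hR a _ (pairwise_disjoint_three hXY hXZ hYZ),
      apply_tensorFin_transport S₁ htr hSP hR a _ (pairwise_disjoint_two hYZ),
      apply_tensorFin_transport S₁ htr hSP hR a _ (pairwise_disjoint_two hXZ),
      apply_tensorFin_transport S₁ htr hSP hR a _ (pairwise_disjoint_two hXY),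
      apply_tensorFin_transport S₁ htr hSP hR a _ (pairwise_disjoint_one X),
      apply_tensorFin_transport S₁ htr hSP hR a _ (pairwise_disjoint_one Y),
      apply_tensorFin_transport S₁ htr hSP hR a _ (pairwise_disjoint_one Z)]
    exact hκ

end TimeSeparatedOfSeparated

open TimeSeparatedOfSeparated in
/-- **`stub_timeSeparatedOfSeparated` (N3b, r15)** — Euclidean symmetry puts a coordinate-separated,
pairwise-disjoint triple into time-separated position without changing `κ₃`: relabel by E3 so that the
isolated function comes first, translate by `c e_m`, swap the axes `0 ↔ m` and, if the isolated ball lies above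
the hyperplane, time-reflect; all `S₁`-terms of `κ₃` are invariant on `⁰𝒮` (OS 1973 §2–3). [folklore] -/
theorem stub_timeSeparatedOfSeparated :
    ∀ (S₁ : SchwingerFamily (EuclideanSpace ℝ (Fin 4))),
      (∀ (n : ℕ) (π : Equiv.Perm (Fin n)) (F : 𝓢((Fin n → EuclideanSpace ℝ (Fin 4)), ℂ)), IsOffDiagonal F →
        S₁ n (permTest π F) = S₁ n F) →
      (∀ (n : ℕ) (a : EuclideanSpace ℝ (Fin 4)) (F : 𝓢((Fin n → EuclideanSpace ℝ (Fin 4)), ℂ)), IsOffDiagonal F →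
        S₁ n (translateMulti a F) = S₁ n F) →
      (∀ (n : ℕ) (R : EuclideanSpace ℝ (Fin 4) ≃ₗᵢ[ℝ] EuclideanSpace ℝ (Fin 4)),
        (∀ i : Fin 4, ∃ j : Fin 4, R (EuclideanSpace.single i 1) = EuclideanSpace.single j 1 ∨
          R (EuclideanSpace.single i 1) = -EuclideanSpace.single j 1) →
        ∀ F : 𝓢((Fin n → EuclideanSpace ℝ (Fin 4)), ℂ), IsOffDiagonal F → S₁ n (linActMulti R F) = S₁ n F) →
      ∀ (f g h : 𝓢(EuclideanSpace ℝ (Fin 4), ℂ)) (p q w : EuclideanSpace ℝ (Fin 4)) (ρ : ℝ), 0 < ρ →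
        tsupport (f : EuclideanSpace ℝ (Fin 4) → ℂ) ⊆ Metric.closedBall p ρ →
        tsupport (g : EuclideanSpace ℝ (Fin 4) → ℂ) ⊆ Metric.closedBall q ρ →
        tsupport (h : EuclideanSpace ℝ (Fin 4) → ℂ) ⊆ Metric.closedBall w ρ →
        Disjoint (tsupport (f : EuclideanSpace ℝ (Fin 4) → ℂ)) (tsupport (g : EuclideanSpace ℝ (Fin 4) → ℂ)) →
        Disjoint (tsupport (f : EuclideanSpace ℝ (Fin 4) → ℂ)) (tsupport (h : EuclideanSpace ℝ (Fin 4) → ℂ)) →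
        Disjoint (tsupport (g : EuclideanSpace ℝ (Fin 4) → ℂ)) (tsupport (h : EuclideanSpace ℝ (Fin 4) → ℂ)) →
        ∀ (m : Fin 4) (c : ℝ),
          ((p m + ρ < c ∧ c + ρ < q m ∧ c + ρ < w m) ∨ (c + ρ < p m ∧ q m + ρ < c ∧ w m + ρ < c) ∨
            (q m + ρ < c ∧ c + ρ < p m ∧ c + ρ < w m) ∨ (c + ρ < q m ∧ p m + ρ < c ∧ w m + ρ < c) ∨
            (w m + ρ < c ∧ c + ρ < p m ∧ c + ρ < q m) ∨ (c + ρ < w m ∧ p m + ρ < c ∧ q m + ρ < c)) →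
        S₁ 3 (SchwartzMap.tensorFin 3 ![f, g, h]) -
              S₁ 1 (SchwartzMap.tensorFin 1 ![f]) * S₁ 2 (SchwartzMap.tensorFin 2 ![g, h]) -
            S₁ 1 (SchwartzMap.tensorFin 1 ![g]) * S₁ 2 (SchwartzMap.tensorFin 2 ![f, h]) -
            S₁ 1 (SchwartzMap.tensorFin 1 ![h]) * S₁ 2 (SchwartzMap.tensorFin 2 ![f, g]) +
            2 * (S₁ 1 (SchwartzMap.tensorFin 1 ![f]) * S₁ 1 (SchwartzMap.tensorFin 1 ![g]) *
              S₁ 1 (SchwartzMap.tensorFin 1 ![h])) ≠ 0 →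
        ∃ (f' g' h' : 𝓢(EuclideanSpace ℝ (Fin 4), ℂ)) (Ffgh : 𝓢((Fin 3 → EuclideanSpace ℝ (Fin 4)), ℂ))
          (Fgh Ffh Ffg : 𝓢((Fin 2 → EuclideanSpace ℝ (Fin 4)), ℂ)) (Ff Fg Fh : 𝓢((Fin 1 → EuclideanSpace ℝ (Fin 4)), ℂ)),
          tsupport (f' : EuclideanSpace ℝ (Fin 4) → ℂ) ⊆ {y : EuclideanSpace ℝ (Fin 4) | y 0 < 0} ∧
          tsupport (g' : EuclideanSpace ℝ (Fin 4) → ℂ) ⊆ {y : EuclideanSpace ℝ (Fin 4) | 0 < y 0} ∧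
          tsupport (h' : EuclideanSpace ℝ (Fin 4) → ℂ) ⊆ {y : EuclideanSpace ℝ (Fin 4) | 0 < y 0} ∧
          IsOffDiagonal Fgh ∧ IsTensorOf Ffgh ![f', g', h'] ∧ IsOffDiagonal Ffgh ∧ IsTensorOf Fgh ![g', h'] ∧
          IsTensorOf Ffh ![f', h'] ∧ IsTensorOf Ffg ![f', g'] ∧ IsTensorOf Ff ![f'] ∧ IsTensorOf Fg ![g'] ∧ IsTensorOf Fh ![h'] ∧
          S₁.toLabelled 3 (fun _ => ()) Ffgh - S₁.toLabelled 1 (fun _ => ()) Ff * S₁.toLabelled 2 (fun _ => ()) Fgh -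
            S₁.toLabelled 1 (fun _ => ()) Fg * S₁.toLabelled 2 (fun _ => ()) Ffh -
            S₁.toLabelled 1 (fun _ => ()) Fh * S₁.toLabelled 2 (fun _ => ()) Ffg +
            2 * (S₁.toLabelled 1 (fun _ => ()) Ff * S₁.toLabelled 1 (fun _ => ()) Fg * S₁.toLabelled 1 (fun _ => ()) Fh) ≠ 0 := by
  intro S₁ hE3 htr hSP f g h p q w ρ _hρ hf hg hh hfg hfh hgh m c hcases hκ
  -- E3 relabellings `(g,f,h)`, `(h,f,g)` of the `S₁`-terms (all tensors are off-diagonal by pairwise disjointness)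
  have hP := pairwise_disjoint_three hfg hfh hgh
  have e3a := apply_tensorFin_perm S₁ hE3 (Equiv.swap (0 : Fin 3) 1) _ hP
  have e3b := apply_tensorFin_perm S₁ hE3 (Equiv.swap (1 : Fin 3) 2 * Equiv.swap (0 : Fin 3) 1) _ hP
  have e2a := apply_tensorFin_perm S₁ hE3 (Equiv.swap (0 : Fin 2) 1) _ (pairwise_disjoint_two hfg)
  have e2b := apply_tensorFin_perm S₁ hE3 (Equiv.swap (0 : Fin 2) 1) _ (pairwise_disjoint_two hgh)
  have e2c := apply_tensorFin_perm S₁ hE3 (Equiv.swap (0 : Fin 2) 1) _ (pairwise_disjoint_two hfh)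
  rw [← vec3_swap01] at e3a
  rw [← vec3_cycle] at e3b
  rw [← vec2_swap] at e2a e2b e2c
  rcases hcases with h0 | h0 | h0 | h0 | h0 | h0
  · exact core S₁ htr hSP hf hg hh hfg hfh hgh (Or.inl h0) hκ
  · exact core S₁ htr hSP hf hg hh hfg hfh hgh (Or.inr h0) hκ
  · refine core S₁ htr hSP hg hf hh hfg.symm hgh hfh (Or.inl h0) fun h1 => hκ ?_
    rw [e3a, e2a] at h1
    linear_combination h1
  · refine core S₁ htr hSP hg hf hh hfg.symm hgh hfh (Or.inr h0) fun h1 => hκ ?_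
    rw [e3a, e2a] at h1
    linear_combination h1
  · refine core S₁ htr hSP hh hf hg hfh.symm hgh.symm hfg (Or.inl h0) fun h1 => hκ ?_
    rw [e3b, e2b, e2c] at h1
    linear_combination h1
  · refine core S₁ htr hSP hh hf hg hfh.symm hgh.symm hfg (Or.inr h0) fun h1 => hκ ?_
    rw [e3b, e2b, e2c] at h1
    linear_combination h1

end Summit.QuantumFields.YangMills.Theorems.WeakCouplingHypercubicLimit.TraceNormColdPressure
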